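import Summits.QuantumFields.YangMills.Theorems.BalabanUVNodesN15KingModelHeatKernelCycleDecay
import Literature.MathematicalPhysics.QuantumFieldTheory.Balaban1983to89.Beta.WoodburyFibre
import Mathlib.Analysis.Real.Pi.Bounds
import HarnessLib

/-!
# BalabanUVNodes ∕ N15 — THE KING-MODEL RUNG (PART Ϣ-g): POINTWISE MAJORANTS FOR THE PRODUCT OF THE FOUR CYCLE HEAT KERNELS ON THE CUBIC FOUR-TORUS —
# `Π_μ‖Q^{(K₀)}_s(z_μ)‖ ≤ 8∕K₀⁴ + 8∕s²` for every `s > 0`, and `Π_μ‖Q^{(K₀)}_s(z_μ)‖ ≤ 17000∕|v(z_ν)|⁴` for `0 < s ≤ |v(z_ν)|²` (every coordinate `ν` with `z_ν ≠ 0`)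
# (the two regions of the time integral of PART Ϣ's η-uniform power law; absolute constants, no mass, no volume)
# (Track A, DAG node N15 = NE2; FAN-OUT v1.1 §N15 s3 «KING-MODEL RUNG … + what the curved case adds»; count-neutral)

HONEST FRAMING.  Count-neutral (cell `pub-ymgap`, seat `pub-ymgap-dag-n15-e` g55; `--supports stmt-QuantumFields-27247 --as helper` = K3ᴬ).  King's `A = 0` covariance on the CUBIC four-torus
`(ℤ∕K₀)⁴` (the tree's `cM K₀`, as in Ϯ-e) satisfies `c·|G(x,y)| ≤ ∫₀^∞e^{−(m²∕c)s}Π_μ‖Q^{(K₀)}_s((x−y)_μ)‖ds` (PART Ϣ-f).  THIS FILE bounds the integrand pointwise in the two regimes of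
the heat-kernel picture, from the three one-dimensional bounds of PARTS Ϣ-d∕Ϣ-e written in the coarse `r = √s` form (`√(π∕8) ≤ 1`, `(π∕2)⁴ ≤ 7`): (B1) `‖Q_s‖ ≤ 1`; (B2) `‖Q_s‖ ≤ 1∕K₀ + 1∕√s`
(diagonal∕mixing); (B3) `‖Q_s(n)‖ ≤ (98s + 588s²)(9∕K₀ + 1∕√s)∕|v(n)|⁴` (decay).  REGION II (`s ≥ |v|²`, also valid for all `s`): all four factors by (B2), `(a+b)⁴ ≤ 8(a⁴+b⁴)`:
★★ **`prod_norm_cycleHeat_le_far`** `≤ 8∕K₀⁴ + 8∕s²` — NO cross terms, hence no `log`: the would-be `K₀⁻²s⁻¹` term is split between the zero mode `K₀⁻⁴` (paid by the mass in PART Ϣ-h: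
`∫e^{−(m²∕c)s}ds∕K₀⁴ = c∕(m²K₀⁴)`) and `s⁻²` (integrable beyond `|v|²` without the mass).  REGION I (`0 < s ≤ |v(z_ν)|²`): the `ν`-factor by (B3), the other three by `min(1, (B2))`:
★★ **`prod_norm_cycleHeat_le_near`** `≤ 17000∕|v(z_ν)|⁴` — the numeric heart ★ `near_numeric_bound`: with `r = √s ≤ n ≤ K₀∕2`, `(98r²+588r⁴)(9∕K₀+1∕r)·min(1,(1∕K₀+1∕r)³) ≤ 17000`
(`r ≤ 1`: `≤ 6860`; `r ≥ 1`: `≤ 2744·(9u⁴+9u+u³+1)`, `u = r∕K₀ ≤ ½`, `= 2744·99∕16 < 16979`).  So `∫₀^{n²} ≤ 17000∕n²` and `∫_{n²}^∞ ≤ 8c∕(m²K₀⁴) + 8∕n²` (PART Ϣ-h).  Constants crude and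
absolute.  `d+1 = 4` and equal periods ONLY (three transverse factors `s^{−3∕2}` against the decay factor's `s^{3∕2}` is exactly the four-dimensional balance; in `d+1 = 3` the same
book-keeping gives `1∕|v|`, the correct three-dimensional law — not typed here).  NOT Bałaban's (3.42); NOT a node discharge; nothing continuum ∕ ℝ⁴ ∕ OS ∕ Clay.
PRIOR TREE ART (by name): PARTS Ϣ-d (`cycleHeat`, `norm_cycleHeat_le_one`, `norm_cycleHeat_le_mixing'`), Ϣ-e (`norm_cycleHeat_le_decay`); `Beta.WoodburyFibre.cM` (the cubic period vector, as in
Ϯ-e); Mathlib `Real.pi_lt_d2`, `Real.pi_gt_three`.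
Dedup (rg at filing): basename 0 files; needles `prod_norm_cycleHeat_le_far|prod_norm_cycleHeat_le_near|near_numeric_bound|norm_cycleHeat_le_inv_add_inv_sqrt|norm_cycleHeat_le_poly_div|prod_le_mul_pow_three` 0 tree files; preflight v1 `dedup.landed` ×2 fixed before filing (`(a+b)⁴ ≤ 8(a⁴+b⁴)` ≡ `MetricEmbeddings.add_pow_four_le`, `(a+b)³ ≤ 4(a³+b³)` ≡ `FluidPDE.Torus.add_pow_three_le` — both now inline `have`s citing those names; the unrelated towers are not imported).
Locators: [King1986] (2.13) p.653, (4.4) p.670, (4.35) p.674; [LawlerLimic2010] §2.3 ∕ Thm 4.3.1 (the heat-kernel route to Green's function bounds).  0 `sorry`, 0 `def`.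
-/

noncomputable section

open Real Set Finset Complex
open scoped BigOperators

namespace Summit.QuantumFields.YangMills.BalabanUVNodes.N15KingModelRung.HeatKernel

open Literature.MathematicalPhysics.QuantumFieldTheory.Balaban1983to89.B5Prop11Plancherel (Tor)
open Literature.MathematicalPhysics.QuantumFieldTheory.Balaban1983to89.Beta.WoodburyFibre (cM)

/-! ## §1 Numerical constants -/

/-- `(π∕2)⁴ ≤ 7` (`π < 3.15`). [folklore] -/
theorem pi_div_two_pow_four_le : (π / 2) ^ 4 ≤ 7 := by
  have h := Real.pi_lt_d2
  have h0 := Real.pi_pos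
  have h1 : π / 2 < 1.575 := by linarith
  have h2 : (π / 2) ^ 4 ≤ (1.575 : ℝ) ^ 4 := pow_le_pow_left₀ (by positivity) h1.le 4
  exact h2.trans (by norm_num)

/-- `√(π∕(8s)) ≤ 1∕√s` for `s > 0` (`π ≤ 8`). [folklore] -/
theorem sqrt_pi_div_le_inv_sqrt {s : ℝ} (hs : 0 < s) : Real.sqrt (π / (8 * s)) ≤ (Real.sqrt s)⁻¹ := by
  have hπ : π ≤ 8 := by linarith [Real.pi_lt_d2]
  rw [← Real.sqrt_inv]
  apply Real.sqrt_le_sqrt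
  rw [div_le_iff₀ (by positivity), inv_mul_eq_div, le_div_iff₀ hs]
  nlinarith

/-! ## §2 The three one-dimensional bounds in `√s`-form -/

variable {K : ℕ} [NeZero K]

/-- (B2) `‖Q^{(K)}_s(k)‖ ≤ 1∕K + 1∕√s` (`s > 0`; PART Ϣ-d `norm_cycleHeat_le_mixing'` with `√(π∕8) ≤ 1`). [cite: King1986, (4.4) p.670, (4.35) p.674] -/
theorem norm_cycleHeat_le_inv_add_inv_sqrt {s : ℝ} (hs : 0 < s) (k : ZMod K) : ‖cycleHeat K s k‖ ≤ (K : ℝ)⁻¹ + (Real.sqrt s)⁻¹ :=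
  (norm_cycleHeat_le_mixing' hs k).trans (add_le_add le_rfl (sqrt_pi_div_le_inv_sqrt hs))

/-- (B3) `‖Q^{(K)}_s(n)‖ ≤ (98s + 588s²)(9∕K + 1∕√s)∕|v(n)|⁴` for `n ≠ 0` (`s > 0`; PART Ϣ-e `norm_cycleHeat_le_decay` with `(π∕2)⁴ ≤ 7`, `√(π∕8) ≤ 1`). [cite: King1986, (4.4) p.670, (4.35) p.674] -/
theorem norm_cycleHeat_le_poly_div {s : ℝ} (hs : 0 < s) {n : ZMod K} (hn : n ≠ 0) :
    ‖cycleHeat K s n‖ ≤ (98 * s + 588 * s ^ 2) * (9 * (K : ℝ)⁻¹ + (Real.sqrt s)⁻¹) / ((n.valMinAbs.natAbs : ℕ) : ℝ) ^ 4 := by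
  refine (norm_cycleHeat_le_decay hs hn).trans ?_
  have h7 := pi_div_two_pow_four_le
  have hsq := sqrt_pi_div_le_inv_sqrt hs
  have hv : (0 : ℝ) < ((n.valMinAbs.natAbs : ℕ) : ℝ) ^ 4 := by
    have : 0 < n.valMinAbs.natAbs := by rw [Nat.pos_iff_ne_zero, Ne, Int.natAbs_eq_zero, ZMod.valMinAbs_eq_zero]; exact hn
    positivity
  apply div_le_div_of_nonneg_right _ hv.le
  have h1 : 9 * (K : ℝ)⁻¹ + Real.sqrt (π / (8 * s)) ≤ 9 * (K : ℝ)⁻¹ + (Real.sqrt s)⁻¹ := by linarith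
  have h0 : 0 ≤ 9 * (K : ℝ)⁻¹ + Real.sqrt (π / (8 * s)) := by positivity
  calc (π / 2) ^ 4 * (14 * s + 84 * s ^ 2) * (9 * (K : ℝ)⁻¹ + Real.sqrt (π / (8 * s)))
      ≤ 7 * (14 * s + 84 * s ^ 2) * (9 * (K : ℝ)⁻¹ + (Real.sqrt s)⁻¹) := by
        apply mul_le_mul (mul_le_mul_of_nonneg_right h7 (by positivity)) h1 h0 (by positivity)
    _ = (98 * s + 588 * s ^ 2) * (9 * (K : ℝ)⁻¹ + (Real.sqrt s)⁻¹) := by ring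

/-! ## §3 The numeric heart of Region I -/

/-- ★ **THE NUMERIC BOUND OF REGION I**: for `0 < r ≤ n`, `1 ≤ n`, `2n ≤ N`: `(98r² + 588r⁴)·(9∕N + 1∕r)·min(1, (1∕N + 1∕r)³) ≤ 17000` — for `r ≤ 1` the first two factors give `≤ 6174 + 686`; for `r ≥ 1`,
`(1∕N+1∕r)³ ≤ 4(N⁻³ + r⁻³)`, `98r²+588r⁴ ≤ 686r⁴` and `r⁴(9∕N+1∕r)(N⁻³+r⁻³) = 9u⁴ + 9u + u³ + 1` with `u = r∕N ≤ ½`, total `≤ 2744·99∕16 < 16979`. [folklore] -/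
theorem near_numeric_bound {r n N : ℝ} (hr : 0 < r) (hrn : r ≤ n) (hn : 1 ≤ n) (hN : 2 * n ≤ N) :
    (98 * r ^ 2 + 588 * r ^ 4) * (9 / N + 1 / r) * min 1 ((1 / N + 1 / r) ^ 3) ≤ 17000 := by
  have hNpos : 0 < N := by linarith
  have hP0 : 0 ≤ 98 * r ^ 2 + 588 * r ^ 4 := by positivity
  have hF0 : 0 ≤ 9 / N + 1 / r := by positivity
  rcases le_or_gt r 1 with hr1 | hr1
  · -- `r ≤ 1`
    have hmin : min 1 ((1 / N + 1 / r) ^ 3) ≤ 1 := min_le_left _ _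
    have hmin0 : 0 ≤ min 1 ((1 / N + 1 / r) ^ 3) := le_min zero_le_one (by positivity)
    have hA : (98 * r ^ 2 + 588 * r ^ 4) * (9 / N) ≤ 6174 := by
      have h1 : 98 * r ^ 2 + 588 * r ^ 4 ≤ 686 := by nlinarith [pow_le_one₀ hr.le hr1 (n := 2), pow_le_one₀ hr.le hr1 (n := 4)]
      have h2 : 9 / N ≤ 9 := by rw [div_le_iff₀ hNpos]; nlinarith
      calc (98 * r ^ 2 + 588 * r ^ 4) * (9 / N) ≤ 686 * 9 := mul_le_mul h1 h2 (by positivity) (by norm_num)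
        _ = 6174 := by norm_num
    have hB : (98 * r ^ 2 + 588 * r ^ 4) * (1 / r) ≤ 686 := by
      rw [show (98 * r ^ 2 + 588 * r ^ 4) * (1 / r) = 98 * r + 588 * r ^ 3 by field_simp]
      nlinarith [pow_le_one₀ hr.le hr1 (n := 3)]
    calc (98 * r ^ 2 + 588 * r ^ 4) * (9 / N + 1 / r) * min 1 ((1 / N + 1 / r) ^ 3)
        ≤ (98 * r ^ 2 + 588 * r ^ 4) * (9 / N + 1 / r) * 1 := mul_le_mul_of_nonneg_left hmin (mul_nonneg hP0 hF0)
      _ = (98 * r ^ 2 + 588 * r ^ 4) * (9 / N) + (98 * r ^ 2 + 588 * r ^ 4) * (1 / r) := by ring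
      _ ≤ 6174 + 686 := add_le_add hA hB
      _ ≤ 17000 := by norm_num
  · -- `r ≥ 1`
    have hmin : min 1 ((1 / N + 1 / r) ^ 3) ≤ 4 * (1 / N ^ 3 + 1 / r ^ 3) := by
      refine (min_le_right _ _).trans ?_
      -- `(a+b)³ ≤ 4(a³+b³)` for `a,b ≥ 0` (the tree's `FluidPDE.Torus.add_pow_three_le`, cited, not imported)
      have ha : (0 : ℝ) ≤ 1 / N := by positivity
      have hb : (0 : ℝ) ≤ 1 / r := by positivity
      have this : (1 / N + 1 / r) ^ 3 ≤ 4 * ((1 / N) ^ 3 + (1 / r) ^ 3) := by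
        nlinarith [sq_nonneg (1 / N - 1 / r), mul_nonneg ha hb, sq_nonneg (1 / N + 1 / r)]
      calc (1 / N + 1 / r) ^ 3 ≤ 4 * ((1 / N) ^ 3 + (1 / r) ^ 3) := this
        _ = 4 * (1 / N ^ 3 + 1 / r ^ 3) := by rw [one_div_pow, one_div_pow]
    have hP : 98 * r ^ 2 + 588 * r ^ 4 ≤ 686 * r ^ 4 := by nlinarith [one_le_pow₀ hr1.le (n := 2), sq_nonneg r]
    set u : ℝ := r / N with hu
    have hu0 : 0 ≤ u := by positivity
    have hu1 : u ≤ 1 / 2 := by rw [hu, div_le_iff₀ hNpos]; linarith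
    have hkey : r ^ 4 * (9 / N + 1 / r) * (1 / N ^ 3 + 1 / r ^ 3) = 9 * u ^ 4 + 9 * u + u ^ 3 + 1 := by
      rw [hu]; field_simp; ring
    have hpoly : 9 * u ^ 4 + 9 * u + u ^ 3 + 1 ≤ 99 / 16 := by
      have h4 : u ^ 4 ≤ (1 / 2) ^ 4 := pow_le_pow_left₀ hu0 hu1 4
      have h3 : u ^ 3 ≤ (1 / 2) ^ 3 := pow_le_pow_left₀ hu0 hu1 3
      nlinarith
    have hG0 : 0 ≤ (9 / N + 1 / r) * (1 / N ^ 3 + 1 / r ^ 3) := by positivity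
    calc (98 * r ^ 2 + 588 * r ^ 4) * (9 / N + 1 / r) * min 1 ((1 / N + 1 / r) ^ 3)
        ≤ (686 * r ^ 4) * (9 / N + 1 / r) * (4 * (1 / N ^ 3 + 1 / r ^ 3)) :=
          mul_le_mul (mul_le_mul_of_nonneg_right hP hF0) hmin (le_min zero_le_one (by positivity)) (by positivity)
      _ = 2744 * (r ^ 4 * (9 / N + 1 / r) * (1 / N ^ 3 + 1 / r ^ 3)) := by ring
      _ = 2744 * (9 * u ^ 4 + 9 * u + u ^ 3 + 1) := by rw [hkey]
      _ ≤ 2744 * (99 / 16) := by nlinarith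
      _ ≤ 17000 := by norm_num

/-! ## §4 Products over the cubic four-torus -/

variable {K₀ : ℕ} [NeZero K₀]

/-- (B1) for the product: `Π_μ‖Q^{(K₀)}_s(z_μ)‖ ≤ 1` (`s ≥ 0`). [cite: King1986, (4.35) p.674] -/
theorem prod_norm_cycleHeat_le_one {s : ℝ} (hs : 0 ≤ s) (z : Tor (cM K₀)) : ∏ μ : Fin 4, ‖cycleHeat K₀ s (z μ)‖ ≤ 1 := by
  calc ∏ μ : Fin 4, ‖cycleHeat K₀ s (z μ)‖ ≤ ∏ _μ : Fin 4, (1 : ℝ) := Finset.prod_le_prod (fun μ _ => norm_nonneg _) (fun μ _ => norm_cycleHeat_le_one hs (z μ))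
    _ = 1 := by simp

/-- ★★ **REGION II (every `s > 0`)**: `Π_μ‖Q^{(K₀)}_s(z_μ)‖ ≤ 8∕K₀⁴ + 8∕s²` — four factors `≤ 1∕K₀ + 1∕√s`, then `(a+b)⁴ ≤ 8(a⁴+b⁴)` (no cross terms). [cite: King1986, (4.4) p.670, (4.35) p.674] -/
theorem prod_norm_cycleHeat_le_far {s : ℝ} (hs : 0 < s) (z : Tor (cM K₀)) :
    ∏ μ : Fin 4, ‖cycleHeat K₀ s (z μ)‖ ≤ 8 / (K₀ : ℝ) ^ 4 + 8 / s ^ 2 := by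
  have hD0 : 0 ≤ (K₀ : ℝ)⁻¹ + (Real.sqrt s)⁻¹ := by positivity
  have h1 : ∏ μ : Fin 4, ‖cycleHeat K₀ s (z μ)‖ ≤ ∏ _μ : Fin 4, ((K₀ : ℝ)⁻¹ + (Real.sqrt s)⁻¹) :=
    Finset.prod_le_prod (fun μ _ => norm_nonneg _) (fun μ _ => norm_cycleHeat_le_inv_add_inv_sqrt hs (z μ))
  rw [Finset.prod_const, Finset.card_univ, Fintype.card_fin] at h1
  -- `(a+b)⁴ ≤ 8(a⁴+b⁴)` (the tree's `MetricEmbeddings.add_pow_four_le`, cited, not imported): `8(a⁴+b⁴) − (a+b)⁴ = (a−b)²(7a²+10ab+7b²)`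
  have h2 : ((K₀ : ℝ)⁻¹ + (Real.sqrt s)⁻¹) ^ 4 ≤ 8 * (((K₀ : ℝ)⁻¹) ^ 4 + ((Real.sqrt s)⁻¹) ^ 4) := by
    set A : ℝ := (K₀ : ℝ)⁻¹
    set B : ℝ := (Real.sqrt s)⁻¹
    have e : 8 * (A ^ 4 + B ^ 4) - (A + B) ^ 4 = (A - B) ^ 2 * (7 * A ^ 2 + 10 * A * B + 7 * B ^ 2) := by ring
    have hq : 0 ≤ 7 * A ^ 2 + 10 * A * B + 7 * B ^ 2 := by nlinarith [sq_nonneg (A + B), sq_nonneg (A - B)]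
    nlinarith [mul_nonneg (sq_nonneg (A - B)) hq]
  have h3 : ((Real.sqrt s)⁻¹) ^ 4 = 1 / s ^ 2 := by
    rw [inv_pow, show (4 : ℕ) = 2 * 2 by norm_num, pow_mul, Real.sq_sqrt hs.le, one_div]
  have h4 : ((K₀ : ℝ)⁻¹) ^ 4 = 1 / (K₀ : ℝ) ^ 4 := by rw [inv_pow, one_div]
  rw [h3, h4] at h2
  calc ∏ μ : Fin 4, ‖cycleHeat K₀ s (z μ)‖ ≤ ((K₀ : ℝ)⁻¹ + (Real.sqrt s)⁻¹) ^ 4 := h1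
    _ ≤ 8 * (1 / (K₀ : ℝ) ^ 4 + 1 / s ^ 2) := h2
    _ = 8 / (K₀ : ℝ) ^ 4 + 8 / s ^ 2 := by ring

/-- Splitting off one coordinate: `Π_μ a_μ ≤ a_ν · D³` when `0 ≤ a_μ ≤ D` for `μ ≠ ν` and `0 ≤ a_ν`. [folklore] -/
theorem prod_le_mul_pow_three {a : Fin 4 → ℝ} {D : ℝ} (ν : Fin 4) (h0 : ∀ μ, 0 ≤ a μ) (hD : ∀ μ, μ ≠ ν → a μ ≤ D) :
    ∏ μ : Fin 4, a μ ≤ a ν * D ^ 3 := by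
  classical
  rw [← Finset.mul_prod_erase Finset.univ a (Finset.mem_univ ν)]
  refine mul_le_mul_of_nonneg_left ?_ (h0 ν)
  have hcard : (Finset.univ.erase ν).card = 3 := by rw [Finset.card_erase_of_mem (Finset.mem_univ ν), Finset.card_univ, Fintype.card_fin]
  calc ∏ μ ∈ Finset.univ.erase ν, a μ ≤ ∏ _μ ∈ Finset.univ.erase ν, D :=
        Finset.prod_le_prod (fun μ _ => h0 μ) (fun μ hμ => hD μ (Finset.ne_of_mem_erase hμ))
    _ = D ^ 3 := by rw [Finset.prod_const, hcard]

/-- ★★ **REGION I (`0 < s ≤ |v(z_ν)|²`)**: if `z_ν ≠ 0` and `0 < s ≤ |v(z_ν)|²` then `Π_μ‖Q^{(K₀)}_s(z_μ)‖ ≤ 17000∕|v(z_ν)|⁴` — the `ν`-factor by the decay bound (B3), the three transverse factors by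
`min(1, 1∕K₀ + 1∕√s)`, and §3 with `r = √s ≤ |v| ≤ K₀∕2`. [cite: King1986, (4.4) p.670, (4.35) p.674] -/
theorem prod_norm_cycleHeat_le_near {s : ℝ} (hs : 0 < s) (z : Tor (cM K₀)) (ν : Fin 4) (hν : z ν ≠ 0)
    (hsn : s ≤ (((z ν).valMinAbs.natAbs : ℕ) : ℝ) ^ 2) :
    ∏ μ : Fin 4, ‖cycleHeat K₀ s (z μ)‖ ≤ 17000 / (((z ν).valMinAbs.natAbs : ℕ) : ℝ) ^ 4 := by
  have hK : (0 : ℝ) < K₀ := by exact_mod_cast Nat.pos_of_ne_zero (NeZero.ne K₀)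
  set n : ℝ := (((z ν).valMinAbs.natAbs : ℕ) : ℝ) with hn
  have hnat : 1 ≤ (z ν).valMinAbs.natAbs := by
    rw [Nat.one_le_iff_ne_zero, Ne, Int.natAbs_eq_zero, ZMod.valMinAbs_eq_zero]; exact hν
  have hn1 : (1 : ℝ) ≤ n := by rw [hn]; exact_mod_cast hnat
  have hN : 2 * n ≤ K₀ := by
    have h : (z ν).valMinAbs.natAbs ≤ K₀ / 2 := ZMod.natAbs_valMinAbs_le (z ν)
    have : 2 * (z ν).valMinAbs.natAbs ≤ K₀ := by omega
    rw [hn]; exact_mod_cast this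
  set r : ℝ := Real.sqrt s with hr
  have hr0 : 0 < r := Real.sqrt_pos.mpr hs
  have hrs : r ^ 2 = s := Real.sq_sqrt hs.le
  have hrn : r ≤ n := by
    rw [hr, ← Real.sqrt_sq (by linarith : (0 : ℝ) ≤ n)]
    exact Real.sqrt_le_sqrt hsn
  -- the `ν`-factor and the transverse bound `D = min 1 (1/K₀ + 1/r)`
  set D : ℝ := min 1 ((K₀ : ℝ)⁻¹ + r⁻¹) with hD
  have hDμ : ∀ μ, ‖cycleHeat K₀ s (z μ)‖ ≤ D := fun μ =>
    le_min (norm_cycleHeat_le_one hs.le (z μ)) (norm_cycleHeat_le_inv_add_inv_sqrt hs (z μ))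
  have hsplit := prod_le_mul_pow_three (a := fun μ => ‖cycleHeat K₀ s (z μ)‖) (D := D) ν (fun μ => norm_nonneg _) (fun μ _ => hDμ μ)
  have hνb := norm_cycleHeat_le_poly_div (K := K₀) hs hν
  have hD0 : 0 ≤ D := le_min zero_le_one (by positivity)
  have hD3 : D ^ 3 = min 1 ((1 / (K₀ : ℝ) + 1 / r) ^ 3) := by
    rw [hD, one_div, one_div]
    rcases le_total (1 : ℝ) ((K₀ : ℝ)⁻¹ + r⁻¹) with h | h
    · rw [min_eq_left h, min_eq_left (one_le_pow₀ h), one_pow]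
    · rw [min_eq_right h, min_eq_right (pow_le_one₀ (by positivity) h)]
  have hnum := near_numeric_bound hr0 hrn hn1 hN
  have hn4 : (0 : ℝ) < n ^ 4 := by positivity
  -- assemble
  have hpoly : (98 * s + 588 * s ^ 2) * (9 * (K₀ : ℝ)⁻¹ + (Real.sqrt s)⁻¹) = (98 * r ^ 2 + 588 * r ^ 4) * (9 / K₀ + 1 / r) := by
    rw [← hr, ← hrs]; ring
  calc ∏ μ : Fin 4, ‖cycleHeat K₀ s (z μ)‖ ≤ ‖cycleHeat K₀ s (z ν)‖ * D ^ 3 := hsplit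
    _ ≤ ((98 * s + 588 * s ^ 2) * (9 * (K₀ : ℝ)⁻¹ + (Real.sqrt s)⁻¹) / n ^ 4) * D ^ 3 := mul_le_mul_of_nonneg_right hνb (pow_nonneg hD0 3)
    _ = ((98 * r ^ 2 + 588 * r ^ 4) * (9 / K₀ + 1 / r) * min 1 ((1 / (K₀ : ℝ) + 1 / r) ^ 3)) / n ^ 4 := by rw [hpoly, hD3]; ring
    _ ≤ 17000 / n ^ 4 := div_le_div_of_nonneg_right hnum hn4.le

end Summit.QuantumFields.YangMills.BalabanUVNodes.N15KingModelRung.HeatKernel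

end
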